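import Literature.MathematicalPhysics.QuantumFieldTheory.Volkov2020.DenominatorSectorExponent
import Literature.MathematicalPhysics.QuantumFieldTheory.Volkov2020.ProjectorTreeExchange
import HarnessLib

/-!
# Volkov 2020 (NPB 961, 115232) §2.1 / proof of Lemma 3.5: the ultraviolet degree `ω(s) = 2·Loop(s) − |s| + ½|Lept(s)|` ON LINE SETS and the I-closure identity «ω(IClos(s)) = ω(s) + 2(Loop(IClos(s)) − Loop(s)) − |IClos(s)∖s| = ω(s) + |IClos(s)∖s| (because the I-closure does not change the number of connectivity components of the set)» — PROVED matroid-generally (the rank of a line set is unchanged by adding photons spanned by their lepton paths) and DISCHARGED for edge lists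

independent recomputation; certified where stated, statistical where stated; no new-physics claim.

CITATION HEADER (venture `QEDPrecision`, cell `pub-qed`, track TROPICAL seat V3b = `pub-qed-trop-v3-lit-2` gen 12; VALUE-FREE: rank / corank
bookkeeping of line sets in a matroid — no integrand, nothing per word). Companion of `Volkov2020.HeppSectorTreeBounds` (B.27: `loopNum` = Loop(s)
AS PRINTED = Panzer's corank), `Volkov2020.DenominatorSectorExponent` (B.28: `iClos` = IClos(s) AS PRINTED on line sets), `Volkov2020.UVDegreeHandshake`
(B.19/B.26: ω and the I-closure identity at the level of COUNTS — `QEDCounts.omega_add_internal_photons` takes «adding k internal photons without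
changing the components» as its modelling input) and `Volkov2020.ProjectorTreeExchange` (B.31 §4: a photon lies in the closure of its lepton path in
the cycle matroid of an edge list). This file states ω on LINE SETS over Loop(s) and proves the I-closure identity of Lemma 3.5's proof from the one
graph fact it rests on, discharged for edge lists. Serves §B.42 of `tropical/view/V3-VOLKOV-DEGREES.md`.

Source. [Volkov2020] S. Volkov, "Infrared and ultraviolet power counting on the mass shell in quantum electrodynamics", Nucl. Phys. B 961
(2020) 115232 = arXiv:1912.04885v4 (e-print tex `iclos_arxiv.tex`, sha256 8613757ca2360833…, held by the cell under
`pub-qed-trop-v3-lit-2/sources/arxiv-1912.04885/`; numbering by section = the journal's), VERBATIM: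
* §2.1 (journal p.7; tex l.157–164): "by Loop(s) we denote the minimum of |s∖T|, where T runs over all 1-trees of G. The *ultraviolet degree
  of divergence* is defined as ω(s) = 2·Loop(s) − |s| + ½|Lept(s)|. For connected sets s it equals 2 − ¾N_Lept − ½N_Ph … We suppose that G
  does not have lepton cycles, and ω(s) < 0 for all s ⊆ E(G) except the empty set and E(G)."
* §2.1 (journal p.7; tex l.169–173): "If i ∈ Ph(E(G)), then by LPath(i) we denote the set of all lines that are on the lepton path connecting
  the vertexes incident to i. By definition, put IClos(s) = s ∪ {i ∈ Ph(E(G)) : LPath(i) ⊆ s}."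
* **proof of Lemma 3.5** (journal p.13; tex l.419–431): "The power of t_l is constituted of the following terms: ⌈−ω(s^{[l]})⌉ +
  ⌊|Lept(s^{[l]})|/2⌋ − |P[s^{[l]}]| (Lemma 3.3; this lemma also gives the denominator of the right part of (3.5)); −Σ_{i∈Ph(IClos(s^{[l]}))} r_i −
  Σ_{i∈IClos(s^{[l]})∖s^{[l]}} r_i (from (3.4)). To conclude the proof it remains to note that for any s ⊆ E(G) we have
  **ω(IClos(s)) = ω(s) + 2(Loop(IClos(s)) − Loop(s)) − |IClos(s)∖s| = ω(s) + |IClos(s)∖s| (because the I-closure does not change the number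
  of connectivity components of the set)**." — with (3.5)–(3.7): "|K(z)/W(z)^M| ≤ C∏ t_l^{⌈−ω(IClos(s^{[l]}))⌉+A_l+B_l}/(z_1…z_L), A_l =
  ⌊|Lept(s^{[l]})|/2⌋ − |P(s^{[l]})| − Σ_{i∈Ph(IClos(s^{[l]}))} r_i, B_l = Σ_{i∈IClos(s^{[l]})∖s^{[l]}} (1 − r_i)".

READING. Lines `Fin L` carry a matroid `M` (the cycle matroid of the graph; any matroid for §3), the lepton lines `Lept` and photons `Ph`
(disjoint), each photon with a lepton path `lpath i`; `Loop(s)` = B.27's `loopNum M s` (= corank, `loopNum_eq_corank`); `ω` (`omegaUV`) is the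
printed formula on line sets, rational-valued; IClos = B.28's `iClos Ph lpath`. «The I-closure does not change the number of connectivity
components» is read as the matroid statement it is used for: the RANK of the line set is unchanged (for a graph, rank(s) = #vertices touched by s −
#components of s, and a photon whose lepton path lies in s touches no new vertex), which follows from the single graph input of B.31's
`lemma39_core`, `hcl : i ∈ closure(LPath(i))` for photons — discharged for edge lists `lep m : m → m+1`, photons `a → b` by B.31 §4.

WHAT THE KERNEL CERTIFIES (all PROVED; Mathlib + B.27/B.28/B.31 only; no named fact, D-0026 net debt 0):
* §1 `omegaUV M Lept s` = **ω(s) AS PRINTED on line sets** (2·Loop(s) − |s| + ½|s ∩ Lept|).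
* §2 `subset_iClos`, `mem_iClos_sdiff` (the added lines are the photons outside s with LPath ⊆ s), `card_iClos`, `iClos_inter_lept` (no lepton line
  is added).
* §3 (ANY matroid, hypothesis `hcl`) **`eRk_iClos`: rank(IClos(s)) = rank(s)**; **`loopNum_iClos`: Loop(IClos(s)) = Loop(s) + |IClos(s)∖s|**;
  `omegaUV_iClos_expand` (the printed intermediate form, pure bookkeeping, any s); **`omegaUV_iClos`: ω(IClos(s)) = ω(s) + |IClos(s)∖s|**;
  `ceil_neg_omegaUV_iClos` (⌈−ω(IClos(s))⌉ = ⌈−ω(s)⌉ − |IClos(s)∖s|); **`lemma35_exponent`**: the collected exponent of Lemma 3.5's proof,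
  ⌈−ω(s)⌉ + a − Σ_{IClos(s)∖s} r_i = ⌈−ω(IClos(s))⌉ + a + Σ_{IClos(s)∖s}(1 − r_i) (= ⌈−ω(IClos(s^{[l]}))⌉ + A_l + B_l with a = A_l's first terms).
* §4 `omegaUV_iClos_edgeList`: both identities for the cycle matroid of an edge list with a lepton path and forward photons, `lpath` = the lepton
  lines between the photon's ends (the graph input discharged by `mem_closure_cycleMatroid_of_path`).
* §5 `oneLoop_omegaUV_iClos`: on the one-loop vertex graph IClos({a,b}) = E(G), Loop: 0 ↦ 1, ω: −1 ↦ 0 (E(G) being the one nonempty set with ω = 0).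
NOT claimed: the identification rank = #vertices − #components for graphs as a statement about components (only its consequence, the rank
identity, is proved — which is all the printed proof uses); Lemma 3.5's inequality (3.5) itself as a statement about K(z), W(z) (its pieces are B.27
Lemma 3.3, B.28 (3.4), B.30 Lemma 3.4); the connected form «2 − ¾N_Lept − ½N_Ph» on line sets (counts level: B.19 `omega_eq_legs`); lepton loops;
anything per word of the cell.
-/

namespace Literature.MathematicalPhysics.QuantumFieldTheory.Volkov2020

open Finset

noncomputable section

variable {L : ℕ}

/-! ## §1 ω(s) AS PRINTED on line sets, over `Loop(s)` AS PRINTED (`loopNum`, B.27) -/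

/-- **The ultraviolet degree of divergence AS PRINTED, on line sets**: «ω(s) = 2·Loop(s) − |s| + ½|Lept(s)|», with `Loop(s)` = `loopNum M s`
(«the minimum of |s∖T|, where T runs over all 1-trees of G», B.27) and `Lept` the set of lepton lines. (The counts-level companion is
`UVDegreeHandshake`'s `QEDCounts.omega`, B.19.) [cite: Volkov2020, §2.1 (journal p.7; arXiv:1912.04885v4 tex l.157–162)] -/
def omegaUV (M : Matroid (Fin L)) (Lept : Finset (Fin L)) (s : Finset (Fin L)) : ℚ :=
  2 * (loopNum M s : ℚ) - (s.card : ℚ) + ((s ∩ Lept).card : ℚ) / 2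

/-! ## §2 The I-closure on line sets: membership bookkeeping -/

section IClos

variable (Ph : Finset (Fin L)) (lpath : Fin L → Finset (Fin L))

/-- `s ⊆ IClos(s)`. [cite: Volkov2020, §2.1 «IClos(s) = s ∪ {i ∈ Ph(E(G)) : LPath(i) ⊆ s}» (journal p.7; arXiv:1912.04885v4 tex l.171–173)] -/
theorem subset_iClos (s : Finset (Fin L)) : s ⊆ iClos Ph lpath s :=
  subset_union_left

/-- The lines added by the I-closure are photons outside `s` whose lepton path lies in `s`.
[cite: Volkov2020, §2.1 (journal p.7; arXiv:1912.04885v4 tex l.171–173)] -/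
theorem mem_iClos_sdiff {s : Finset (Fin L)} {i : Fin L} :
    i ∈ iClos Ph lpath s \ s ↔ i ∈ Ph ∧ lpath i ⊆ s ∧ i ∉ s := by
  unfold iClos
  rw [mem_sdiff, mem_union, mem_filter]
  tauto

/-- `|IClos(s)| = |s| + |IClos(s) ∖ s|`. [cite: Volkov2020, §2.1 (journal p.7; arXiv:1912.04885v4 tex l.171–173)] -/
theorem card_iClos (s : Finset (Fin L)) : (iClos Ph lpath s).card = s.card + (iClos Ph lpath s \ s).card := by
  rw [card_sdiff_of_subset (subset_iClos Ph lpath s)]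
  have := card_le_card (subset_iClos Ph lpath s); omega

/-- The I-closure adds no lepton line: `IClos(s) ∩ Lept = s ∩ Lept` when photons are not lepton lines.
[cite: Volkov2020, §2.1 (journal p.7; arXiv:1912.04885v4 tex l.157, l.171–173)] -/
theorem iClos_inter_lept {Lept : Finset (Fin L)} (hdisj : Disjoint Ph Lept) (s : Finset (Fin L)) :
    iClos Ph lpath s ∩ Lept = s ∩ Lept := by
  ext i
  unfold iClos
  simp only [mem_inter, mem_union, mem_filter]
  constructor
  · rintro ⟨h | ⟨hP, _⟩, hL⟩
    · exact ⟨h, hL⟩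
    · exact absurd hL (disjoint_left.1 hdisj hP)
  · rintro ⟨h, hL⟩
    exact ⟨Or.inl h, hL⟩

end IClos

/-! ## §3 «The I-closure does not change the number of connectivity components»: rank, Loop and ω of IClos(s) (any matroid) -/

section Matroid

variable (M : Matroid (Fin L)) (Ph : Finset (Fin L)) (lpath : Fin L → Finset (Fin L))

/-- **The rank of a line set is unchanged by its I-closure** — the matroid form of «the I-closure does not change the number of connectivity
components of the set» (rank of a line set of a graph = #vertices touched − #components, and a photon whose lepton path lies in `s` touches no
new vertex): every added photon lies in the closure of its lepton path, hence of `s`. Hypothesis `hcl` as in B.31's `lemma39_core`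
(discharged for edge lists by `mem_closure_cycleMatroid_of_path`). [cite: Volkov2020, proof of Lemma 3.5 (journal p.13; arXiv:1912.04885v4 tex l.425–428)] -/
theorem eRk_iClos (hcl : ∀ i ∈ Ph, i ∈ M.closure (lpath i : Set (Fin L))) (s : Finset (Fin L)) :
    M.eRk ((iClos Ph lpath s : Finset (Fin L)) : Set (Fin L)) = M.eRk (s : Set (Fin L)) := by
  apply le_antisymm
  · have hsub : ((iClos Ph lpath s : Finset (Fin L)) : Set (Fin L)) ⊆ M.closure (s : Set (Fin L)) ∪ (s : Set (Fin L)) := by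
      intro i hi
      rw [mem_coe] at hi
      unfold iClos at hi
      rcases mem_union.1 hi with h | h
      · exact Or.inr (mem_coe.2 h)
      · obtain ⟨hP, hpath⟩ := mem_filter.1 h
        exact Or.inl (M.closure_subset_closure (coe_subset.2 hpath) (hcl i hP))
    calc M.eRk ((iClos Ph lpath s : Finset (Fin L)) : Set (Fin L))
        ≤ M.eRk (M.closure (s : Set (Fin L)) ∪ (s : Set (Fin L))) := M.eRk_mono hsub
      _ = M.eRk (s : Set (Fin L)) := by rw [Matroid.eRk_union_closure_left_eq, Set.union_self]
  · exact M.eRk_mono (coe_subset.2 (subset_iClos Ph lpath s))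

/-- **Loop(IClos(s)) = Loop(s) + |IClos(s) ∖ s|**: each photon spanned by its lepton path adds exactly one loop.
[cite: Volkov2020, proof of Lemma 3.5 «2(Loop(IClos(s)) − Loop(s)) − |IClos(s)∖s| = |IClos(s)∖s| (because the I-closure does not change the number of connectivity components of the set)» (journal p.13; arXiv:1912.04885v4 tex l.425–428)] -/
theorem loopNum_iClos (hcl : ∀ i ∈ Ph, i ∈ M.closure (lpath i : Set (Fin L))) (s : Finset (Fin L)) :
    loopNum M (iClos Ph lpath s) = loopNum M s + (iClos Ph lpath s \ s).card := by
  rw [loopNum_eq_corank, loopNum_eq_corank]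
  have h1 := Literature.Combinatorics.Matroid.eRk_toNat_add_corank M (iClos Ph lpath s)
  have h2 := Literature.Combinatorics.Matroid.eRk_toNat_add_corank M s
  rw [eRk_iClos M Ph lpath hcl s, card_iClos Ph lpath s] at h1
  omega

/-- The printed intermediate form, valid for ANY line set (pure bookkeeping of the definition of ω, photons carrying no ½):
`ω(IClos(s)) = ω(s) + 2(Loop(IClos(s)) − Loop(s)) − |IClos(s)∖s|`. [cite: Volkov2020, proof of Lemma 3.5 (journal p.13; arXiv:1912.04885v4 tex l.425–427)] -/
theorem omegaUV_iClos_expand {Lept : Finset (Fin L)} (hdisj : Disjoint Ph Lept) (s : Finset (Fin L)) :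
    omegaUV M Lept (iClos Ph lpath s) =
      omegaUV M Lept s + 2 * ((loopNum M (iClos Ph lpath s) : ℚ) - loopNum M s) - ((iClos Ph lpath s \ s).card : ℚ) := by
  unfold omegaUV
  rw [iClos_inter_lept Ph lpath hdisj s, card_iClos Ph lpath s]
  push_cast
  ring

/-- **«ω(IClos(s)) = ω(s) + |IClos(s) ∖ s|»** for every line set `s`, in any matroid in which each photon lies in the closure of its lepton
path. [cite: Volkov2020, proof of Lemma 3.5 (journal p.13; arXiv:1912.04885v4 tex l.425–428)] -/
theorem omegaUV_iClos {Lept : Finset (Fin L)} (hdisj : Disjoint Ph Lept)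
    (hcl : ∀ i ∈ Ph, i ∈ M.closure (lpath i : Set (Fin L))) (s : Finset (Fin L)) :
    omegaUV M Lept (iClos Ph lpath s) = omegaUV M Lept s + ((iClos Ph lpath s \ s).card : ℚ) := by
  rw [omegaUV_iClos_expand M Ph lpath hdisj s, loopNum_iClos M Ph lpath hcl s]
  push_cast
  ring

/-- The Speer exponent of (1.5) / Lemma 3.3 through the I-closure: `⌈−ω(IClos(s))⌉ = ⌈−ω(s)⌉ − |IClos(s) ∖ s|`.
[cite: Volkov2020, proof of Lemma 3.5 (journal p.13; arXiv:1912.04885v4 tex l.419–428)] -/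
theorem ceil_neg_omegaUV_iClos {Lept : Finset (Fin L)} (hdisj : Disjoint Ph Lept)
    (hcl : ∀ i ∈ Ph, i ∈ M.closure (lpath i : Set (Fin L))) (s : Finset (Fin L)) :
    ⌈-omegaUV M Lept (iClos Ph lpath s)⌉ = ⌈-omegaUV M Lept s⌉ - ((iClos Ph lpath s \ s).card : ℤ) := by
  rw [omegaUV_iClos M Ph lpath hdisj hcl s, neg_add, ← Int.cast_natCast, ← Int.cast_neg, Int.ceil_add_intCast]
  ring

/-- **The exponent bookkeeping of Lemma 3.5's proof.** «The power of t_l is constituted of the following terms: ⌈−ω(s^{[l]})⌉ + ⌊|Lept(s^{[l]})|/2⌋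
− |P[s^{[l]}]| (Lemma 3.3 …); −Σ_{i∈Ph(IClos(s^{[l]}))} r_i − Σ_{i∈IClos(s^{[l]})∖s^{[l]}} r_i (from (3.4)). To conclude the proof it remains to
note that … ω(IClos(s)) = ω(s) + |IClos(s)∖s|»: with `a = ⌊|Lept(s)|/2⌋ − |P[s]| − Σ_{Ph(IClos(s))} r_i` the collected exponent equals
`⌈−ω(IClos(s))⌉ + a + B`, `B = Σ_{i∈IClos(s)∖s}(1 − r_i)` — i.e. (3.5)'s `⌈−ω(IClos(s^{[l]}))⌉ + A_l + B_l`.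
[cite: Volkov2020, Lemma 3.5 eq. (3.5)–(3.7) and its proof (journal p.13; arXiv:1912.04885v4 tex l.406–431)] -/
theorem lemma35_exponent {Lept : Finset (Fin L)} (hdisj : Disjoint Ph Lept)
    (hcl : ∀ i ∈ Ph, i ∈ M.closure (lpath i : Set (Fin L))) (s : Finset (Fin L)) (a : ℚ) (r : Fin L → ℚ) :
    (⌈-omegaUV M Lept s⌉ : ℚ) + a - ∑ i ∈ iClos Ph lpath s \ s, r i =
      (⌈-omegaUV M Lept (iClos Ph lpath s)⌉ : ℚ) + a + ∑ i ∈ iClos Ph lpath s \ s, (1 - r i) := by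
  rw [ceil_neg_omegaUV_iClos M Ph lpath hdisj hcl s, sum_sub_distrib, sum_const, nsmul_eq_mul, mul_one]
  push_cast
  ring

end Matroid

/-! ## §4 The graph input discharged: edge lists with a lepton path -/

section EdgeList

variable {N V : ℕ}

/-- For an edge list on the vertices `0,…,V` with lepton lines `lep m : m → m+1` and every photon `i` running `a → b` (`a ≤ b`) with lepton
path `lep k`, `a ≤ k < b` (`lpathOf`-style data given as `lpath`), the hypothesis `hcl` holds for the cycle matroid (B.31
`mem_closure_cycleMatroid_of_path`), so **Loop(IClos(s)) = Loop(s) + |IClos(s)∖s| and ω(IClos(s)) = ω(s) + |IClos(s)∖s| hold for every line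
set of such a graph.** [cite: Volkov2020, proof of Lemma 3.5 (journal p.13; arXiv:1912.04885v4 tex l.425–428)] -/
theorem omegaUV_iClos_edgeList (E : Fin N → Fin (V + 1) × Fin (V + 1)) (lep : Fin V → Fin N)
    (hlep : ∀ m : Fin V, ((E (lep m)).1 : ℕ) = m ∧ ((E (lep m)).2 : ℕ) = m + 1)
    (Ph : Finset (Fin N)) (hPh : ∀ i ∈ Ph, ((E i).1 : ℕ) ≤ (E i).2) (hdisj : Disjoint Ph (univ.image lep))
    (s : Finset (Fin N)) :
    let lpath : Fin N → Finset (Fin N) := fun i => (univ.filter fun k : Fin V => ((E i).1 : ℕ) ≤ k ∧ (k : ℕ) < (E i).2).image lep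
    loopNum (cycleMatroid E) (iClos Ph lpath s) = loopNum (cycleMatroid E) s + (iClos Ph lpath s \ s).card ∧
      omegaUV (cycleMatroid E) (univ.image lep) (iClos Ph lpath s) =
        omegaUV (cycleMatroid E) (univ.image lep) s + ((iClos Ph lpath s \ s).card : ℚ) := by
  intro lpath
  have hcl : ∀ i ∈ Ph, i ∈ (cycleMatroid E).closure (lpath i : Set (Fin N)) := by
    intro i hi
    have hab := hPh i hi
    have hbV : ((E i).2 : ℕ) ≤ V := Nat.le_of_lt_succ (E i).2.isLt
    refine mem_closure_cycleMatroid_of_path E hab rfl rfl (fun k => if h : k < V then lep ⟨k, h⟩ else i) ?_ (lpath i) ?_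
    · intro k hak hkb
      have hkV : k < V := lt_of_lt_of_le hkb hbV
      simp only [dif_pos hkV]
      exact hlep ⟨k, hkV⟩
    · intro k hak hkb
      have hkV : k < V := lt_of_lt_of_le hkb hbV
      simp only [dif_pos hkV]
      exact mem_image_of_mem _ (mem_filter.2 ⟨mem_univ _, hak, hkb⟩)
  exact ⟨loopNum_iClos _ Ph lpath hcl s, omegaUV_iClos _ Ph lpath hdisj hcl s⟩

end EdgeList

/-! ## §5 Non-vacuity: the one-loop vertex graph -/

section OneLoop

/-- On the one-loop vertex graph `oneLoopEdges` (leptons `a = 0`, `b = 1`, photon `γ = 2`, LPath(γ) = {a, b}): IClos({a, b}) = {a, b, γ} = E(G),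
Loop rises from 0 to 1 and ω from −1 to 0 = ω({a,b}) + |{γ}| — the printed identity on the smallest example (and E(G) is the one set with ω = 0).
[cite: Volkov2020, §2.1 «ω(s) < 0 for all s ⊆ E(G) except the empty set and E(G)» and proof of Lemma 3.5 (journal p.7, p.13; arXiv:1912.04885v4 tex l.162–164, l.425–428)] -/
theorem oneLoop_omegaUV_iClos :
    let lpath : Fin 3 → Finset (Fin 3) := fun _ => {0, 1}
    iClos ({2} : Finset (Fin 3)) lpath {0, 1} = univ ∧
      loopNum (cycleMatroid oneLoopEdges) {0, 1} = 0 ∧ loopNum (cycleMatroid oneLoopEdges) univ = 1 ∧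
      omegaUV (cycleMatroid oneLoopEdges) {0, 1} {0, 1} = -1 ∧ omegaUV (cycleMatroid oneLoopEdges) {0, 1} univ = 0 := by
  intro lpath
  have hI : iClos ({2} : Finset (Fin 3)) lpath {0, 1} = univ := by decide
  have hcl : ∀ i ∈ ({2} : Finset (Fin 3)), i ∈ (cycleMatroid oneLoopEdges).closure (lpath i : Set (Fin 3)) := by
    intro i hi
    rw [mem_singleton] at hi
    subst hi
    exact oneLoop_photon_mem_closure
  -- Loop({a,b}) = 0: the lepton path is a 1-tree
  have h0 : loopNum (cycleMatroid oneLoopEdges) {0, 1} = 0 := by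
    have h := loopNum_le (cycleMatroid oneLoopEdges) ({0, 1} : Finset (Fin 3)) oneLoop_isBase_lept
    have he : (({0, 1} : Finset (Fin 3)) \ {0, 1}).card = 0 := by decide
    rw [he] at h
    exact Nat.le_zero.1 h
  have h1 : loopNum (cycleMatroid oneLoopEdges) univ = 1 := by
    have h := loopNum_iClos (cycleMatroid oneLoopEdges) {2} lpath hcl {0, 1}
    rw [hI, h0] at h
    rw [h]
    decide
  refine ⟨hI, h0, h1, ?_, ?_⟩
  · unfold omegaUV
    have hc1 : (({0, 1} : Finset (Fin 3))).card = 2 := by decide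
    have hc2 : (({0, 1} : Finset (Fin 3)) ∩ {0, 1}).card = 2 := by decide
    rw [h0, hc1, hc2]
    norm_num
  · unfold omegaUV
    have hc1 : (univ : Finset (Fin 3)).card = 3 := by decide
    have hc2 : ((univ : Finset (Fin 3)) ∩ {0, 1}).card = 2 := by decide
    rw [h1, hc1, hc2]
    norm_num

end OneLoop

end

end Literature.MathematicalPhysics.QuantumFieldTheory.Volkov2020
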